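import Summits.AtomisticToContinuum.Crystallization.Theorems.ExcessDecayLiouvilleSiteGeometry

/-!
# Route `ExcessDecayLiouville`: lattice coordinates

Bookkeeping for steps (c3)–(c4) of the energy route for item `ExcessDecay` (stmt-AtomisticToContinuum-9334): the
lattice vector `z(i,j,k) = i u₁ + j u₂ + k w₃ ∈ Λ₀` as a function of its integer coordinates — membership, additivity
(so that the sites `t_m + A z(i,j,k)` of a sublattice are parametrised by `ℤ³`, with the coordinate shifts realised by
the translations `A u₁`, `A u₂`, `A w₃`), and the two-sided comparison between the coordinates and the Euclidean norm:

* `norm_latticeVec_le` : `‖z(i,j,k)‖ ≤ |i| + |j| + 2|k|`;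
* `abs_coord_le_norm_latticeVec` : `|i| ≤ 2‖z‖`, `|j| ≤ 2‖z‖`, `|k| ≤ ‖z‖`;
* `abs_coord_le_norm_apply_latticeVec` : with an admissible cell, `|i|, |j| ≤ (400/189)‖A z‖`, `|k| ≤ (200/189)‖A z‖`,

so that a box of coordinate half-width `n` lies in a ball of radius `4n` and the sites of a ball of radius `r` have
coordinates (relative to any of them) of size `≤ (400/189)·2r/… ≤ 5r`.  All `[folklore]`; helper lemmas, nothing here
closes an item.
-/

noncomputable section

namespace Summit.AtomisticToContinuum.Crystallization.Theorems.ExcessDecayLiouville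

open scoped BigOperators
open Literature.MathematicalPhysics.StatisticalMechanics
open Summit.AtomisticToContinuum.Crystallization.Theorems.PhononStabilityNegative

/-- `z(i,j,k) ∈ Λ₀`. [folklore] -/
theorem latticeVec_mem_Λ₀ (i j k : ℤ) :
    ((i : ℝ) • triangularVec₁ 1 + (j : ℝ) • triangularVec₂ 1 +
      (k : ℝ) • layerNormal (2 * Real.sqrt (2 / 3)) : (EuclideanSpace ℝ (Fin 3))) ∈ Λ₀ :=
  ⟨i, j, k, rfl⟩

/-- Additivity of `z(i,j,k)` in the coordinates. [folklore] -/
theorem latticeVec_add (i j k i' j' k' : ℤ) :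
    (((i + i' : ℤ) : ℝ) • triangularVec₁ 1 + ((j + j' : ℤ) : ℝ) • triangularVec₂ 1 +
      ((k + k' : ℤ) : ℝ) • layerNormal (2 * Real.sqrt (2 / 3)) : (EuclideanSpace ℝ (Fin 3))) =
    ((i : ℝ) • triangularVec₁ 1 + (j : ℝ) • triangularVec₂ 1 + (k : ℝ) • layerNormal (2 * Real.sqrt (2 / 3))) +
    ((i' : ℝ) • triangularVec₁ 1 + (j' : ℝ) • triangularVec₂ 1 + (k' : ℝ) • layerNormal (2 * Real.sqrt (2 / 3))) := by
  push_cast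
  module

/-- Coordinate shifts are the lattice translations: `z(i+1,j,k) = z(i,j,k) + u₁`, `z(i,j+1,k) = z(i,j,k) + u₂`,
`z(i,j,k+1) = z(i,j,k) + w₃`. [folklore] -/
theorem latticeVec_succ (i j k : ℤ) :
    (((i + 1 : ℤ) : ℝ) • triangularVec₁ 1 + (j : ℝ) • triangularVec₂ 1 +
        (k : ℝ) • layerNormal (2 * Real.sqrt (2 / 3)) : (EuclideanSpace ℝ (Fin 3))) =
      ((i : ℝ) • triangularVec₁ 1 + (j : ℝ) • triangularVec₂ 1 + (k : ℝ) • layerNormal (2 * Real.sqrt (2 / 3))) +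
        triangularVec₁ 1 ∧
    ((i : ℝ) • triangularVec₁ 1 + ((j + 1 : ℤ) : ℝ) • triangularVec₂ 1 +
        (k : ℝ) • layerNormal (2 * Real.sqrt (2 / 3)) : (EuclideanSpace ℝ (Fin 3))) =
      ((i : ℝ) • triangularVec₁ 1 + (j : ℝ) • triangularVec₂ 1 + (k : ℝ) • layerNormal (2 * Real.sqrt (2 / 3))) +
        triangularVec₂ 1 ∧
    ((i : ℝ) • triangularVec₁ 1 + (j : ℝ) • triangularVec₂ 1 +
        ((k + 1 : ℤ) : ℝ) • layerNormal (2 * Real.sqrt (2 / 3)) : (EuclideanSpace ℝ (Fin 3))) =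
      ((i : ℝ) • triangularVec₁ 1 + (j : ℝ) • triangularVec₂ 1 + (k : ℝ) • layerNormal (2 * Real.sqrt (2 / 3))) +
        layerNormal (2 * Real.sqrt (2 / 3)) := by
  refine ⟨?_, ?_, ?_⟩ <;> (push_cast; module)

/-- `‖z(i,j,k)‖ ≤ |i| + |j| + 2|k|` (the generators have lengths `1, 1, 2√(2/3) ≤ 2`). [folklore] -/
theorem norm_latticeVec_le (i j k : ℤ) :
    ‖((i : ℝ) • triangularVec₁ 1 + (j : ℝ) • triangularVec₂ 1 +
      (k : ℝ) • layerNormal (2 * Real.sqrt (2 / 3)) : (EuclideanSpace ℝ (Fin 3)))‖ ≤ |(i : ℝ)| + |(j : ℝ)| + 2 * |(k : ℝ)| := by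
  have hsq := hcpLiouvilleLam_norm_sq i j k
  set N := ‖((i : ℝ) • triangularVec₁ 1 + (j : ℝ) • triangularVec₂ 1 +
      (k : ℝ) • layerNormal (2 * Real.sqrt (2 / 3)) : (EuclideanSpace ℝ (Fin 3)))‖ with hN
  have hN0 : 0 ≤ N := norm_nonneg _
  have hrhs : ((i : ℝ) ^ 2 + i * j + j ^ 2) + 8 / 3 * (k : ℝ) ^ 2 ≤ (|(i : ℝ)| + |(j : ℝ)| + 2 * |(k : ℝ)|) ^ 2 := by
    have hi := sq_abs (i : ℝ); have hj := sq_abs (j : ℝ); have hk := sq_abs (k : ℝ)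
    have hij : (i : ℝ) * j ≤ |(i : ℝ)| * |(j : ℝ)| := by rw [← abs_mul]; exact le_abs_self _
    nlinarith [abs_nonneg (i : ℝ), abs_nonneg (j : ℝ), abs_nonneg (k : ℝ)]
  have h0 : 0 ≤ |(i : ℝ)| + |(j : ℝ)| + 2 * |(k : ℝ)| := by positivity
  rw [← hsq] at hrhs
  exact (pow_le_pow_iff_left₀ hN0 h0 two_ne_zero).1 hrhs

/-- `|i| ≤ 2‖z‖`, `|j| ≤ 2‖z‖`, `|k| ≤ ‖z‖` for `z = z(i,j,k)` (from `‖z‖² = i² + ij + j² + (8/3)k²`). [folklore] -/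
theorem abs_coord_le_norm_latticeVec (i j k : ℤ) :
    |(i : ℝ)| ≤ 2 * ‖((i : ℝ) • triangularVec₁ 1 + (j : ℝ) • triangularVec₂ 1 +
      (k : ℝ) • layerNormal (2 * Real.sqrt (2 / 3)) : (EuclideanSpace ℝ (Fin 3)))‖ ∧
    |(j : ℝ)| ≤ 2 * ‖((i : ℝ) • triangularVec₁ 1 + (j : ℝ) • triangularVec₂ 1 +
      (k : ℝ) • layerNormal (2 * Real.sqrt (2 / 3)) : (EuclideanSpace ℝ (Fin 3)))‖ ∧
    |(k : ℝ)| ≤ ‖((i : ℝ) • triangularVec₁ 1 + (j : ℝ) • triangularVec₂ 1 +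
      (k : ℝ) • layerNormal (2 * Real.sqrt (2 / 3)) : (EuclideanSpace ℝ (Fin 3)))‖ := by
  have hsq := hcpLiouvilleLam_norm_sq i j k
  set N := ‖((i : ℝ) • triangularVec₁ 1 + (j : ℝ) • triangularVec₂ 1 +
      (k : ℝ) • layerNormal (2 * Real.sqrt (2 / 3)) : (EuclideanSpace ℝ (Fin 3)))‖ with hN
  have hN0 : 0 ≤ N := norm_nonneg _
  -- i² + ij + j² ≥ (3/4) i², (3/4) j²
  have hform_i : (3 / 4 : ℝ) * (i : ℝ) ^ 2 ≤ N ^ 2 := by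
    rw [hsq]; nlinarith [sq_nonneg ((j : ℝ) + (i : ℝ) / 2), sq_nonneg (k : ℝ)]
  have hform_j : (3 / 4 : ℝ) * (j : ℝ) ^ 2 ≤ N ^ 2 := by
    rw [hsq]; nlinarith [sq_nonneg ((i : ℝ) + (j : ℝ) / 2), sq_nonneg (k : ℝ)]
  have hform_k : (k : ℝ) ^ 2 ≤ N ^ 2 := by
    rw [hsq]; nlinarith [sq_nonneg ((i : ℝ) + (j : ℝ) / 2), sq_nonneg (j : ℝ), sq_nonneg (k : ℝ)]
  refine ⟨?_, ?_, ?_⟩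
  · exact abs_le_of_sq_le_sq (by nlinarith [hform_i]) (by positivity)
  · exact abs_le_of_sq_le_sq (by nlinarith [hform_j]) (by positivity)
  · exact abs_le_of_sq_le_sq (by nlinarith [hform_k]) hN0

/-- With an admissible cell (`‖A z‖ ≥ (189/200)‖z‖`): `|i|, |j| ≤ (400/189)‖A z‖` and `|k| ≤ (200/189)‖A z‖`. [folklore] -/
theorem abs_coord_le_norm_apply_latticeVec {A : (EuclideanSpace ℝ (Fin 3)) →L[ℝ] (EuclideanSpace ℝ (Fin 3))}
    (hA : Adm₀ A) (i j k : ℤ) :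
    |(i : ℝ)| ≤ 400 / 189 * ‖A ((i : ℝ) • triangularVec₁ 1 + (j : ℝ) • triangularVec₂ 1 +
      (k : ℝ) • layerNormal (2 * Real.sqrt (2 / 3)))‖ ∧
    |(j : ℝ)| ≤ 400 / 189 * ‖A ((i : ℝ) • triangularVec₁ 1 + (j : ℝ) • triangularVec₂ 1 +
      (k : ℝ) • layerNormal (2 * Real.sqrt (2 / 3)))‖ ∧
    |(k : ℝ)| ≤ 200 / 189 * ‖A ((i : ℝ) • triangularVec₁ 1 + (j : ℝ) • triangularVec₂ 1 +
      (k : ℝ) • layerNormal (2 * Real.sqrt (2 / 3)))‖ := by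
  obtain ⟨hi, hj, hk⟩ := abs_coord_le_norm_latticeVec i j k
  have hAz := hcpLiouvilleAdm_norm_le hA ((i : ℝ) • triangularVec₁ 1 + (j : ℝ) • triangularVec₂ 1 +
      (k : ℝ) • layerNormal (2 * Real.sqrt (2 / 3)))
  refine ⟨?_, ?_, ?_⟩ <;> nlinarith [hi, hj, hk, hAz]

end Summit.AtomisticToContinuum.Crystallization.Theorems.ExcessDecayLiouville

end
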